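import Summits.Ventures.PercRepro.ProfilePointedCircuitClassesFiveParallelPair
import Summits.Ventures.PercRepro.ProfilePointedCircuitClassesStarSharpP

/-!
# PercRepro — THE PARALLEL-PAIR REGIME OF `StarNine`, PART A: THE TRANSFERS ALONG A PARALLEL PAIR AND THE
SUMMED FORM OF (★)
(p5, gen 57; `proofs/P5-GM1.md` §85)

Let `x ∥ x′` be two distinct parallel non-loops of `N`.  Every bi-independent set contains exactly one of them
(`mem_or_mem_of_mem_biIndepSets_of_parallel`), so every pointed count splits along the pair, and the sets through `x`
are the lifts `T + x` of the bi-independent sets of the minor `N ／ x′ ∖ x` (`card_class_thru_eq_thruCount_contract_delete`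
with the circuit `{x, x′}`).  This file records the three transfers the regime needs — the split of a `thru` count, the
transfer of a `thru` count along the pair, the rank of the minor — and the two double-counting identities behind the
SUMMED form of (★): `Σ_{e′ ≠ f} in_k(e′) + in_k(f) = k · P_k` and `Σ_{e′ ≠ f} thru_k({e′, f}) = (k − 1) · in_k(f)`.
-/

open scoped Matroid

namespace PercRepro.Cogirth

open Finset ThmH Skew Shadow Profile

open Classical

variable {α : Type} [DecidableEq α] {N : Matroid α} [N.Finite]

section StarNineParA

/-- **THE SPLIT OF A `thru` COUNT ALONG A PARALLEL PAIR**: for `x ∥ x′`,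
`thru_k(S) = thru_k(S + x) + thru_k(S + x′)`. -/
theorem thruCount_eq_thruCount_insert_add_thruCount_insert_of_parallel {x x' : α} (hx : x ∈ gr N)
    (hx' : x' ∈ gr N) (hxx' : x ≠ x') (hrx : rk N {x} = 1) (hcl : x' ∈ clF N {x}) (S : Finset α) (k : ℕ) :
    thruCount N k S = thruCount N k (insert x S) + thruCount N k (insert x' S) := by
  unfold thruCount
  rw [← card_filter_add_card_filter_not (s := (biIndepSets N k).filter (fun X => S ⊆ X)) (fun X => x ∈ X),
    filter_filter, filter_filter]
  congr 1
  · apply congrArg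
    apply filter_congr
    intro W _
    rw [insert_subset_iff]
    tauto
  · apply congrArg
    apply filter_congr
    intro W hW
    rw [insert_subset_iff]
    rcases mem_or_mem_of_mem_biIndepSets_of_parallel hx hx' hxx' hrx hcl hW with h | h
    · exact ⟨fun h' => absurd h.1 h'.2, fun h' => absurd h'.1 h.2⟩
    · exact ⟨fun h' => ⟨h.1, h'.1⟩, fun h' => ⟨h'.2, h.2⟩⟩

/-- **THE TRANSFER OF A `thru` COUNT ALONG A PARALLEL PAIR**: for `s₁ ∥ f` and `s₁, f ∉ T`, the bi-independent
`k`-sets containing `T + s₁` are in bijection with the bi-independent `(k − 1)`-sets of `N ／ f ∖ s₁` containing `T`. -/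
theorem thruCount_insert_eq_thruCount_minor_of_parallel {s₁ f : α} (hs1f : s₁ ≠ f) (hs₁ : s₁ ∈ gr N)
    (hf : f ∈ gr N) (hr1 : rk N {s₁} = 1) (hrf : rk N {f} = 1) (hfcl : f ∈ clF N {s₁}) {T : Finset α}
    (hs1T : s₁ ∉ T) (hfT : f ∉ T) {k : ℕ} (hk : 1 ≤ k) :
    thruCount N k (insert s₁ T) = thruCount ((N ／ ({f} : Set α)) ＼ ({s₁} : Set α)) (k - 1) T := by
  have hC : ({s₁} : Finset α) ⊆ gr N := singleton_subset_iff.2 hs₁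
  have hxC : f ∉ ({s₁} : Finset α) := by rw [mem_singleton]; exact fun h => hs1f h.symm
  have hrk : rk N {s₁} = ({s₁} : Finset α).card := by rw [hr1, card_singleton]
  have hfund : ∀ c ∈ ({s₁} : Finset α), f ∉ clF N (({s₁} : Finset α).erase c) := by
    intro c hc
    rw [mem_singleton] at hc
    rw [hc, erase_singleton]
    intro h0
    have h := rk_insert_eq hf (empty_subset (gr N)) (M := N)
    rw [insert_empty, if_pos h0] at h
    have h1 : rk N ∅ = 0 := Nat.le_zero.1 ((rk_le_card (M := N) ∅).trans (by rw [card_empty]))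
    omega
  have h := card_class_thru_eq_thruCount_contract_delete hC hf hxC hrk hfcl hfund (mem_singleton_self s₁) hfT
    hs1T hk
  rw [erase_singleton, empty_union] at h
  rw [← h]
  unfold thruCount
  congr 1
  apply filter_congr
  intro W hW
  have hW' := hW
  rw [mem_biIndepSets] at hW'
  obtain ⟨_, _, hWrk, _⟩ := hW'
  constructor
  · intro hSW
    have hs₁W : s₁ ∈ W := hSW (mem_insert_self _ _)
    exact ⟨singleton_subset_iff.2 hs₁W,
      not_mem_of_mem_of_rk_eq_card_of_parallel hs₁ hf hs1f hr1 hfcl hWrk hs₁W, (insert_subset_iff.1 hSW).2⟩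
  · rintro ⟨h1, _, h2⟩
    exact insert_subset (h1 (mem_singleton_self _)) h2

/-- **THE RANK OF THE MINOR `N ／ f ∖ s₁`**: for a non-loop `f` and `X ⊆ E − f − s₁`, `ρ_{N／f∖s₁}(X) + 1 = ρ_N(X + f)`. -/
theorem rk_minor_add_one_of_nonloop {s₁ f : α} (hrf : rk N {f} = 1) {X : Finset α}
    (hX : X ⊆ ((gr N).erase f).erase s₁) :
    rk ((N ／ ({f} : Set α)) ＼ ({s₁} : Set α)) X + 1 = rk N (insert f X) := by
  have hfind : N.Indep ({f} : Set α) := by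
    have := indep_of_rk_eq_card' (M := N) (X := {f}) (by rw [hrf, card_singleton])
    simpa using this
  have hX' : X ⊆ (gr (N ／ ({f} : Set α))).erase s₁ := by rw [gr_contract']; exact hX
  have hX'' : X ⊆ (gr N).erase f := hX.trans (erase_subset _ _)
  rw [rk_delete hX', rk_contract_add_one hfind hX'']

/-- **THE MINOR `N ／ f ∖ s₁` OF A COLOOP-FREE MATROID ALONG A PARALLEL PAIR `s₁ ∥ f` IS COLOOP-FREE**: for every
`y ∈ E − f − s₁`, `ρ_{N／f∖s₁}((E − f − s₁) − y) + 1 = ρ_N(E)`. -/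
theorem rk_erase_minor_add_one_of_parallel (hcf : ∀ y ∈ gr N, rk N ((gr N).erase y) = rk N (gr N))
    {s₁ f : α} (hs1f : s₁ ≠ f) (hs₁ : s₁ ∈ gr N) (hf : f ∈ gr N) (hr1 : rk N {s₁} = 1) (hrf : rk N {f} = 1)
    (hfcl : f ∈ clF N {s₁}) {y : α} (hy : y ∈ ((gr N).erase f).erase s₁) :
    rk ((N ／ ({f} : Set α)) ＼ ({s₁} : Set α)) ((((gr N).erase f).erase s₁).erase y) + 1 = rk N (gr N) := by
  rw [rk_minor_add_one_of_nonloop hrf (erase_subset _ _)]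
  have hys : y ≠ s₁ := (mem_erase.1 hy).1
  have hyf : y ≠ f := (mem_erase.1 (mem_erase.1 hy).2).1
  have hyg : y ∈ gr N := (mem_erase.1 (mem_erase.1 hy).2).2
  have e1 : insert f ((((gr N).erase f).erase s₁).erase y) = ((gr N).erase s₁).erase y := by
    ext a
    simp only [mem_insert, mem_erase]
    constructor
    · rintro (rfl | ⟨hay, has, haf, hag⟩)
      · exact ⟨hyf.symm, fun h => hs1f h.symm, hf⟩
      · exact ⟨hay, has, hag⟩
    · rintro ⟨hay, has, hag⟩
      by_cases haf : a = f
      · exact Or.inl haf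
      · exact Or.inr ⟨hay, has, haf, hag⟩
  rw [e1]
  have hs1cl : s₁ ∈ clF N {f} := mem_clF_singleton_of_parallel hs₁ hf hr1 hrf hfcl
  have hfin : f ∈ ((gr N).erase s₁).erase y := mem_erase.2 ⟨hyf.symm, mem_erase.2 ⟨fun h => hs1f h.symm, hf⟩⟩
  have hs1cl' : s₁ ∈ clF N (((gr N).erase s₁).erase y) :=
    mem_clF_of_subset (singleton_subset_iff.2 hfin) hs1cl
  have e2 : insert s₁ (((gr N).erase s₁).erase y) = (gr N).erase y := by
    ext a
    simp only [mem_insert, mem_erase]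
    constructor
    · rintro (rfl | ⟨hay, _, hag⟩)
      · exact ⟨hys.symm, hs₁⟩
      · exact ⟨hay, hag⟩
    · rintro ⟨hay, hag⟩
      by_cases has : a = s₁
      · exact Or.inl has
      · exact Or.inr ⟨hay, has, hag⟩
  have h3 := rk_insert_eq hs₁ (M := N) ((erase_subset _ _).trans (erase_subset _ _) :
    ((gr N).erase s₁).erase y ⊆ gr N)
  rw [if_pos hs1cl', e2, hcf y hyg] at h3
  exact h3.symm

/-- **THE SWAP OF A `thru` COUNT ALONG A PARALLEL PAIR**: for `x ∥ x′` and `f ∉ {x, x′}`,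
`thru_k({x′, f}) = thru_k({x, f})`. -/
theorem thruCount_pair_swap_of_parallel {x x' f : α} (hx : x ∈ gr N) (hx' : x' ∈ gr N) (hxx' : x ≠ x')
    (hrx : rk N {x} = 1) (hrx' : rk N {x'} = 1) (hcl : x' ∈ clF N {x}) (hfx : f ≠ x) (hfx' : f ≠ x') (k : ℕ) :
    thruCount N k {x', f} = thruCount N k {x, f} := by
  have hcl' : x ∈ clF N {x'} := mem_clF_singleton_of_parallel hx hx' hrx hrx' hcl
  have hpair : rk N {x, x'} = 1 := by
    have h := rk_insert_eq hx (singleton_subset_iff.2 hx') (M := N)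
    rw [if_pos hcl', hrx'] at h
    exact h
  have hP : ∀ W : Finset α, f ∈ insert x (W.erase x') ↔ f ∈ W := by
    intro W
    rw [mem_insert, mem_erase]
    exact ⟨fun h => h.elim (fun h' => absurd h' hfx) (fun h' => h'.2), fun h => Or.inr ⟨hfx', h⟩⟩
  have hP' : ∀ W : Finset α, f ∈ insert x' (W.erase x) ↔ f ∈ W := by
    intro W
    rw [mem_insert, mem_erase]
    exact ⟨fun h => h.elim (fun h' => absurd h' hfx') (fun h' => h'.2), fun h => Or.inr ⟨hfx, h⟩⟩
  have h := card_filter_swap_of_parallel hx hx' hxx' hrx hrx' hpair k (fun W => f ∈ W) hP hP'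
  unfold thruCount
  have e1 : (biIndepSets N k).filter (fun W => ({x', f} : Finset α) ⊆ W) =
      (biIndepSets N k).filter (fun W => (f ∈ W ∧ x' ∈ W) ∧ x ∉ W) := by
    apply filter_congr
    intro W hW
    rw [insert_subset_iff, singleton_subset_iff]
    constructor
    · rintro ⟨h1, h2⟩
      exact ⟨⟨h2, h1⟩, not_mem_of_mem_of_rk_eq_card_of_parallel hx' hx hxx'.symm hrx' hcl'
        (mem_biIndepSets.1 hW).2.2.1 h1⟩
    · rintro ⟨⟨h1, h2⟩, _⟩
      exact ⟨h2, h1⟩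
  have e2 : (biIndepSets N k).filter (fun W => ({x, f} : Finset α) ⊆ W) =
      (biIndepSets N k).filter (fun W => (f ∈ W ∧ x' ∉ W) ∧ x ∈ W) := by
    apply filter_congr
    intro W hW
    rw [insert_subset_iff, singleton_subset_iff]
    constructor
    · rintro ⟨h1, h2⟩
      exact ⟨⟨h2, not_mem_of_mem_of_rk_eq_card_of_parallel hx hx' hxx' hrx hcl
        (mem_biIndepSets.1 hW).2.2.1 h1⟩, h1⟩
    · rintro ⟨⟨h1, _⟩, h2⟩
      exact ⟨h2, h1⟩
  rw [e1, e2]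
  exact h

/-- The points of `E − f` lying in a bi-independent set `W` are the points of `W − f`. -/
theorem filter_erase_mem_eq_erase {k : ℕ} {W : Finset α} (hW : W ∈ biIndepSets N k) (f : α) :
    ((gr N).erase f).filter (fun a => a ∈ W) = W.erase f := by
  have hWg : W ⊆ gr N := (mem_biIndepSets.1 hW).1
  ext a
  simp only [mem_filter, mem_erase]
  exact ⟨fun h => ⟨h.1.1, h.2⟩, fun h => ⟨⟨h.1, hWg h.2⟩, h.2⟩⟩

/-- **THE FIRST DOUBLE COUNT**: `Σ_{e′ ∈ E − f} in_k(e′) + in_k(f) = k · P_k` — every bi-independent `k`-set is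
counted once by each of its `k` points. -/
theorem sum_inCount_erase_add_inCount (k : ℕ) (f : α) :
    (∑ e' ∈ (gr N).erase f, inCount N k e') + inCount N k f = k * (biIndepSets N k).card := by
  unfold inCount
  have h := sum_card_bipartiteAbove_eq_sum_card_bipartiteBelow (fun (a : α) (W : Finset α) => a ∈ W)
    (s := (gr N).erase f) (t := biIndepSets N k)
  simp only [bipartiteAbove, bipartiteBelow] at h
  rw [h, card_filter, ← sum_add_distrib, mul_comm]
  apply sum_const_nat
  intro W hW
  have hWk : W.card = k := (mem_biIndepSets.1 hW).2.1
  rw [filter_erase_mem_eq_erase hW f]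
  by_cases hfW : f ∈ W
  · rw [if_pos hfW, card_erase_add_one hfW, hWk]
  · rw [if_neg hfW, erase_eq_of_notMem hfW, hWk, add_zero]

/-- **THE SECOND DOUBLE COUNT**: `Σ_{e′ ∈ E − f} thru_k({e′, f}) = (k − 1) · in_k(f)` — every bi-independent `k`-set
through `f` is counted once by each of its other `k − 1` points. -/
theorem sum_thruCount_pair_erase (k : ℕ) (f : α) :
    ∑ e' ∈ (gr N).erase f, thruCount N k {e', f} = (k - 1) * inCount N k f := by
  unfold thruCount inCount
  have h := sum_card_bipartiteAbove_eq_sum_card_bipartiteBelow (fun (a : α) (W : Finset α) => a ∈ W)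
    (s := (gr N).erase f) (t := (biIndepSets N k).filter (fun W => f ∈ W))
  simp only [bipartiteAbove, bipartiteBelow] at h
  have e1 : ∀ e' ∈ (gr N).erase f, ((biIndepSets N k).filter (fun W => ({e', f} : Finset α) ⊆ W)).card =
      (((biIndepSets N k).filter (fun W => f ∈ W)).filter (fun W => e' ∈ W)).card := by
    intro e' _
    rw [filter_filter]
    congr 1
    apply filter_congr
    intro W _
    rw [insert_subset_iff, singleton_subset_iff]
    exact ⟨fun h' => ⟨h'.2, h'.1⟩, fun h' => ⟨h'.2, h'.1⟩⟩
  rw [sum_congr rfl e1, h, mul_comm]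
  apply sum_const_nat
  intro W hW
  rw [mem_filter] at hW
  have hWk : W.card = k := (mem_biIndepSets.1 hW.1).2.1
  rw [filter_erase_mem_eq_erase hW.1 f, card_erase_of_mem hW.2, hWk]

end StarNineParA

end PercRepro.Cogirth
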